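import Literature.NumberTheory.Automorphic.HeckePointValuesFiniteExtension
import Literature.NumberTheory.GaloisRepresentations.PadicIntermediateFieldIntegers
import HarnessLib

/-!
# The residual eigensystem of a `p`-adically automorphic `ρ` is a MAXIMAL (open, non-Eisenstein) ideal

Topic `NumberTheory/Automorphic`; namespace `Literature.NumberTheory.Automorphic.BigHeckeGLn.TameLevel`.
THEOREMS ONLY (no definition, no named fact, no `sorry`).  Third part of the dictionary (a) of
`Literature.NumberTheory.Automorphic.Pan2022_proModularDeRhamClassical_GL2Q` ("the residual
eigensystem `x mod 𝔪_E` has an open MAXIMAL kernel `𝔪` … non-Eisenstein"), after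
`PadicallyAutomorphicResidualEigensystem` (integrality; `𝔪_x` open, prime, non-Eisenstein) and
`HeckePointValuesFiniteExtension` (values in a finite `E/ℚ_p`); kept in a separate leaf because the
finiteness of the residue field of `𝒪_E` (`intermediateFieldIntegers.finite_residueField`) lives in
the `p`-adic Hodge cone (`PadicIntermediateFieldIntegers`).

* `mem_maximalIdeal_padicAlgClIntegers_iff` — the maximal ideal of `ℤ̄_p` is `{‖a‖ < 1}`;
  `TameLevel.mem_ker_residue_comp_iff` — `t ∈ 𝔪_x ⟺ ‖x(t)‖ < 1`.
* **`TameLevel.isMaximal_ker_residue_comp`** — if the integral point `x₀ : 𝕋(K^p) → ℤ̄_p` takes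
  values in a finite `E/ℚ_p`, the kernel `𝔪_x` of `x₀ mod 𝔪` is MAXIMAL: it is also the kernel of
  `x₀ mod 𝔪_E : 𝕋(K^p) → 𝒪_E → k_E` (both kernels are `{‖x(t)‖ < 1}`), and `𝕋(K^p)/𝔪_x ↪ k_E` is a
  finite integral domain, hence a field.
* **`TameLevel.IsPadicallyAutomorphic.exists_isMaximal_isNonEisenstein`** — for `ρ : Γ_K → GL_n(ℚ̄_p)`
  `p`-adically automorphic of tame level `𝒰` and residually absolutely irreducible there are a
  MAXIMAL, OPEN, NON-EISENSTEIN ideal `𝔪 ⊂ 𝕋(K^p)` and an integral point `x₀` over `𝔪`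
  (`IsPointOver`) with `x₀ ⊗ ℚ̄_p` associated with `ρ` — exactly the standing hypotheses
  "`𝔪` maximal and non-Eisenstein" of [GeeNewton2020, §3.3 (after Def. 3.3.4)] and of the named facts
  of `CompletedCohomologyHeckeAlgebraGLnFacts`.

## References

* T. Gee, J. Newton, J. Inst. Math. Jussieu (2020), §2.1.3 (the maximal ideals of `𝕋^S(U^p)` have
  finite residue fields), §3.3. [GeeNewton2020]
* F. Calegari, M. Emerton, *Completed cohomology — a survey* (2012), §1.8. [CalegariEmerton2011]
* L. Pan, Forum Math. Pi 10 (2022), §6.1.1. [Pan2022LocallyAnalytic]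
-/

noncomputable section

open scoped NumberField
open IsDedekindDomain Field
open Literature.NumberTheory.GaloisRepresentations

namespace Literature.NumberTheory.Automorphic

namespace BigHeckeGLn

/-- **The maximal ideal of `ℤ̄_p` is the open unit ball**: `a ∈ 𝔪_{ℤ̄_p} ⟺ ‖a‖ < 1`
(an element of the valuation ring `{‖a‖ ≤ 1}` is a non-unit iff `‖a‖ < 1`). [folklore] -/
theorem mem_maximalIdeal_padicAlgClIntegers_iff {p : ℕ} [Fact p.Prime] (a : padicAlgClIntegers p) :
    a ∈ IsLocalRing.maximalIdeal (padicAlgClIntegers p) ↔ ‖(a : PadicAlgCl p)‖ < 1 := by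
  rw [IsLocalRing.mem_maximalIdeal, mem_nonunits_iff]
  have h := Valuation.Integer.not_isUnit_iff_valuation_lt_one
    (v := (Valued.v : Valuation (PadicAlgCl p) NNReal)) (x := a)
  rw [PadicAlgCl.valuation_def, ← NNReal.coe_lt_coe, coe_nnnorm, NNReal.coe_one] at h
  exact h

namespace TameLevel

variable {n : ℕ} {K : Type} [Field K] [NumberField K] {p : ℕ} [Fact p.Prime]
  (𝒰 : TameLevel n K p)

/-- `t` lies in the kernel `𝔪_x` of the residual eigensystem `x₀ mod 𝔪` iff `‖x(t)‖ < 1`. [folklore] -/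
theorem mem_ker_residue_comp_iff (x₀ : CompletedCohomologyHeckeAlgebraGLn 𝒰 →+* padicAlgClIntegers p)
    (t : CompletedCohomologyHeckeAlgebraGLn 𝒰) :
    t ∈ RingHom.ker ((IsLocalRing.residue (padicAlgClIntegers p)).comp x₀) ↔
      ‖((x₀ t : padicAlgClIntegers p) : PadicAlgCl p)‖ < 1 := by
  rw [RingHom.mem_ker, RingHom.comp_apply, IsLocalRing.residue_eq_zero_iff,
    mem_maximalIdeal_padicAlgClIntegers_iff]

/-- **The kernel of the residual eigensystem of an `𝒪_E`-valued point is maximal.**  If the integral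
point `x₀ : 𝕋(K^p) → ℤ̄_p` takes its values in an intermediate field `E`, finite over `ℚ_p`, then
`𝔪_x = ker (x₀ mod 𝔪)` is a maximal ideal of `𝕋(K^p)`: it is the kernel of
`x₀ mod 𝔪_E : 𝕋(K^p) → 𝒪_E → k_E` (`𝔪_E = 𝔪_{ℤ̄_p} ∩ 𝒪_E = {‖·‖ < 1}`), whose image is a subring
of the FINITE field `k_E` (`intermediateFieldIntegers.finite_residueField`), a finite integral
domain, hence a field. [cite: GeeNewton2020, §2.1.3] -/
theorem isMaximal_ker_residue_comp (x₀ : CompletedCohomologyHeckeAlgebraGLn 𝒰 →+* padicAlgClIntegers p)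
    (E : IntermediateField ℚ_[p] (PadicAlgCl p)) [FiniteDimensional ℚ_[p] E]
    (hE : ∀ t, ((x₀ t : padicAlgClIntegers p) : PadicAlgCl p) ∈ E) :
    (RingHom.ker ((IsLocalRing.residue (padicAlgClIntegers p)).comp x₀)).IsMaximal := by
  -- the `𝒪_E`-valued corestriction of `x = x₀ ⊗ ℚ̄_p`
  set x : CompletedCohomologyHeckeAlgebraGLn 𝒰 →+* PadicAlgCl p :=
    (padicAlgClIntegers p).subtype.comp x₀ with hx
  have hxE : ∀ t, x t ∈ E := hE
  set xE' : CompletedCohomologyHeckeAlgebraGLn 𝒰 →+* E := x.codRestrict E hxE with hxE'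
  have hmem : ∀ t, xE' t ∈ intermediateFieldIntegers p E := fun t => by
    rw [mem_intermediateFieldIntegers_iff]
    change ‖((x₀ t : padicAlgClIntegers p) : PadicAlgCl p)‖ ≤ 1
    have h := (x₀ t).2
    rw [Valuation.mem_valuationSubring_iff, PadicAlgCl.valuation_def, ← NNReal.coe_le_coe,
      coe_nnnorm, NNReal.coe_one] at h
    exact h
  set xE : CompletedCohomologyHeckeAlgebraGLn 𝒰 →+* intermediateFieldIntegers p E :=
    xE'.codRestrict (intermediateFieldIntegers p E) hmem with hxEdef
  set ψE := (IsLocalRing.residue (intermediateFieldIntegers p E)).comp xE with hψE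
  have hker : RingHom.ker ((IsLocalRing.residue (padicAlgClIntegers p)).comp x₀) = RingHom.ker ψE := by
    ext t
    rw [𝒰.mem_ker_residue_comp_iff, RingHom.mem_ker, RingHom.comp_apply,
      IsLocalRing.residue_eq_zero_iff, intermediateFieldIntegers.mem_maximalIdeal_iff,
      intermediateFieldIntegers.norm_coe]
    rfl
  rw [hker]
  haveI := intermediateFieldIntegers.finite_residueField E
  have hfield : IsField (CompletedCohomologyHeckeAlgebraGLn 𝒰 ⧸ RingHom.ker ψE) :=
    MulEquiv.isField (Finite.isField_of_domain ψE.range)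
      (RingHom.quotientKerEquivRange ψE).toMulEquiv
  exact Ideal.Quotient.maximal_of_isField _ hfield

/-- **`p`-adically automorphic and residually absolutely irreducible ⟹ a maximal, open,
non-Eisenstein ideal with an integral point over it.**  For `ρ : Γ_K → GL_n(ℚ̄_p)` `p`-adically
automorphic of tame level `𝒰` (`IsPadicallyAutomorphic`) with an absolutely irreducible reduction
(`FramedGaloisRep.IsResiduallyAbsIrreducible`) there are a MAXIMAL OPEN ideal `𝔪 ⊂ 𝕋(K^p)` which is
NON-EISENSTEIN (`IsNonEisenstein`: `ρ̄` is an absolutely irreducible residual representation at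
`𝔪`) and an integral point `x₀ : 𝕋(K^p) → ℤ̄_p` over `𝔪` (`IsPointOver 𝔪 x₀`) with `x₀ ⊗ ℚ̄_p`
associated with `ρ`: the kernel of the residual eigensystem
(`IsPadicallyAutomorphic.exists_isResidualRepAt`), maximal because `x₀` is `𝒪_E`-valued for a finite
`E/ℚ_p` (`IsAssociated.exists_intermediateField_forall_apply_mem`, `isMaximal_ker_residue_comp`).
This is the pair of standing hypotheses "`𝔪` maximal, non-Eisenstein" of
[cite: GeeNewton2020, §3.3 (standing hypotheses after Def. 3.3.4)] [cite: CalegariEmerton2011, §1.8]. -/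
theorem IsPadicallyAutomorphic.exists_isMaximal_isNonEisenstein {ρ : FramedGaloisRep K (PadicAlgCl p) n}
    (hρ : 𝒰.IsPadicallyAutomorphic ρ) (hirr : ρ.IsResiduallyAbsIrreducible) :
    ∃ (𝔪 : Ideal (CompletedCohomologyHeckeAlgebraGLn 𝒰))
      (x₀ : CompletedCohomologyHeckeAlgebraGLn 𝒰 →+* padicAlgClIntegers p),
      𝔪.IsMaximal ∧ IsOpen (𝔪 : Set (CompletedCohomologyHeckeAlgebraGLn 𝒰)) ∧
      𝒰.IsNonEisenstein 𝔪 ∧ 𝒰.IsPointOver 𝔪 x₀ ∧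
      𝒰.IsAssociated ((padicAlgClIntegers p).subtype.comp x₀) ρ := by
  letI : TopologicalSpace (padicAlgClResidueField p) := ⊥
  haveI : DiscreteTopology (padicAlgClResidueField p) := ⟨rfl⟩
  obtain ⟨τ, hτ, habs⟩ := hirr
  obtain ⟨x₀, τ', hx, hτ', hopen, -, hpt, hres⟩ := hρ.exists_isResidualRepAt 𝒰 hτ
  obtain ⟨E, hfin, hE⟩ := IsAssociated.exists_intermediateField_forall_apply_mem 𝒰
    (continuous_subtype_val.comp hpt.1) hx
  haveI := hfin
  refine ⟨_, x₀, 𝒰.isMaximal_ker_residue_comp x₀ E hE, hopen,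
    ⟨padicAlgClResidueField p, inferInstance, ⊥, ⟨rfl⟩, _, τ', hres, ?_⟩, hpt, hx⟩
  rw [FramedRep.isAbsolutelyIrreducible_iff_coe, hτ']
  exact habs

end TameLevel

end BigHeckeGLn

end Literature.NumberTheory.Automorphic
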